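import Summits.Ventures.PackingBounds.Configurations.ListConfig
import Summits.Ventures.PackingBounds.Configurations.SectionTransfer
import Summits.Ventures.PackingBounds.ThreePointCert.C6TProof
import Summits.Ventures.PackingBounds.ThreePointCert.C5TProof

/-!
# `A(6, arccos 1/3) ≥ 32` and `A(5, arccos 1/3) ≥ 20`: sections of `E₇` and `E₆` ('spheres touching two touching spheres')

Framing: lottery ticket; floor = certified bounds/negative ranges. Venture `PackingBounds` (cell
`pub-packcert`, seat `pub-packcert-energy`) — the **attained side** of the cell's table of bounds for
`A(n, arccos 1/3)` (Conway–Sloane, *SPLAG* Ch. 9 Table 9.2: how many unit spheres can touch two touching unit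
spheres in `ℝⁿ⁺¹` = the largest spherical code of angle `arccos 1/3` in `ℝⁿ`).

If `u` is a minimal vector of a lattice (or root system) with minimal vectors `M` of norm `m`, the vectors
`w ∈ M` with `w·u = m/2` project to `u^⊥` as `w − u/2`, of norm `3m/4` and pairwise inner products `≤ m/4`: a
spherical code of angle `arccos 1/3` one dimension down. From `E₇` (`126` roots; `32` neighbours at `60°`) this gives
**`32` points in `ℝ⁶`** — in coordinates the half-cube `(±1)⁶` with an even number of minus signs — and from `E₆`
(`72` roots; `20` neighbours) **`20` points in `ℝ⁵`**, the Table 9.2 values for `n = 6, 5`. The data are the points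
`2w − u` in the doubled `E₈` coordinates of `KissingE7.lean` / `KissingE6.lean` (norm `24`, dot products `8, −8, −24`);
the kernel checks the distance distribution and the orthogonality to the normals, `Config.exists_section` moves the
configurations to `ℝ⁶` / `ℝ⁵`, and the cell's kernel-checked three-point bounds give the brackets
`32 ≤ A(6, arccos 1/3) ≤ 35` and `20 ≤ A(5, arccos 1/3) ≤ 23`.

## References
* J. H. Conway, N. J. A. Sloane, *Sphere Packings, Lattices and Groups*, Ch. 9 Table 9.2; Ch. 4 §8.3–8.4. [`ConwaySloane1999`]
-/

namespace Summit.Ventures.PackingBounds.Config.CodeThird6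

open Finset Summit.Ventures.PackingBounds.Config

/-- The `32` points `2w − u` (`w` a root of `E₇` with `w·u = 4`, `u = (2, −2, 0, …, 0)`), doubled `E₈` coordinates, norm `24`.
[cite: ConwaySloane1999, Ch. 9 Table 9.2] -/
def vecs : List (List ℤ) := [
  [0, 0, 2, 2, 2, 2, 2, -2], [0, 0, 2, 2, 2, 2, -2, 2],
  [0, 0, 2, 2, 2, -2, 2, 2], [0, 0, 2, 2, 2, -2, -2, -2],
  [0, 0, 2, 2, -2, 2, 2, 2], [0, 0, 2, 2, -2, 2, -2, -2],
  [0, 0, 2, 2, -2, -2, 2, -2], [0, 0, 2, 2, -2, -2, -2, 2],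
  [0, 0, 2, -2, 2, 2, 2, 2], [0, 0, 2, -2, 2, 2, -2, -2],
  [0, 0, 2, -2, 2, -2, 2, -2], [0, 0, 2, -2, 2, -2, -2, 2],
  [0, 0, 2, -2, -2, 2, 2, -2], [0, 0, 2, -2, -2, 2, -2, 2],
  [0, 0, 2, -2, -2, -2, 2, 2], [0, 0, 2, -2, -2, -2, -2, -2],
  [0, 0, -2, 2, 2, 2, 2, 2], [0, 0, -2, 2, 2, 2, -2, -2],
  [0, 0, -2, 2, 2, -2, 2, -2], [0, 0, -2, 2, 2, -2, -2, 2],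
  [0, 0, -2, 2, -2, 2, 2, -2], [0, 0, -2, 2, -2, 2, -2, 2],
  [0, 0, -2, 2, -2, -2, 2, 2], [0, 0, -2, 2, -2, -2, -2, -2],
  [0, 0, -2, -2, 2, 2, 2, -2], [0, 0, -2, -2, 2, 2, -2, 2],
  [0, 0, -2, -2, 2, -2, 2, 2], [0, 0, -2, -2, 2, -2, -2, -2],
  [0, 0, -2, -2, -2, 2, 2, 2], [0, 0, -2, -2, -2, 2, -2, -2],
  [0, 0, -2, -2, -2, -2, 2, -2], [0, 0, -2, -2, -2, -2, -2, 2]]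
/-- Distance table: dot products `8, −8, −24` (cosines `1/3, −1/3, −1`) with multiplicities per point. -/
def table : List (ℤ × ℕ) := [(-24, 1), (-8, 15), (8, 15)]
/-- Normals cutting out the subspace: the `E₇` normals of the tree file and the root `u`. -/
def normals : List (List ℤ) := [
  [2, 2, 0, 0, 0, 0, 0, 0], [2, -2, 0, 0, 0, 0, 0, 0]]

/-- Kernel check: `32` coordinate lists. -/
theorem length_vecs : vecs.length = 32 := by decide +kernel

set_option maxRecDepth 100000 in
/-- Kernel check: every list has length `8` and squared length `24`. -/
private theorem shape_vecs : shapeOK vecs 8 (24 : ℤ) = true := by decide +kernel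

/-- Kernel check: the table keys are distinct and differ from the squared length. -/
private theorem keys_table : keysOK table (24 : ℤ) = true := by decide +kernel

set_option maxRecDepth 100000 in
/-- Kernel check: the distance distribution (`8 ×15, −8 ×15, −24 ×1` per point). -/
private theorem hist_vecs : histOK vecs table vecs = true := by decide +kernel

/-- The coordinate lists are pairwise distinct (from the checks). -/
private theorem nodup_vecs : vecs.Nodup := nodup_of_checks shape_vecs keys_table hist_vecs

/-- Kernel check: the normals have length `8`, are nonzero and pairwise orthogonal. -/
private theorem normals_ok : normalsOK normals 8 = true := by decide +kernel

set_option maxRecDepth 100000 in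
/-- Kernel check: every point is orthogonal to every normal. -/
private theorem orth_ok : orthOK normals vecs = true := by decide +kernel

/-- `ι q > 0`. -/
private theorem hq : 0 < (Int.castRingHom ℝ) (24 : ℤ) := by simp

/-- **The configuration in `ℝ^6`**: `32` unit vectors with pairwise inner products in `{1/3, −1/3, −1}` and the
tabulated energy. -/
theorem exists_config : ∃ C : Finset (EuclideanSpace ℝ (Fin 6)), C.card = 32 ∧ (∀ x ∈ C, ‖x‖ = 1) ∧
    (∀ x ∈ C, ∀ y ∈ C, x ≠ y → inner ℝ x y ≤ 1 / 3) ∧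
    ∀ a : ℝ → ℝ, ∑ x ∈ C, ∑ y ∈ C.erase x, a (inner ℝ x y) =
      (32 : ℝ) * (a (-1) + 15 * a (-1 / 3) + 15 * a (1 / 3)) := by
  obtain ⟨C, hc, hn, hi, he⟩ := exists_section Int.cast_injective hq shape_vecs keys_table hist_vecs
    nodup_vecs normals normals_ok orth_ok (n := 6) (by decide)
  refine ⟨C, by rw [hc, length_vecs], hn, fun x hx y hy hxy => ?_, fun a => ?_⟩
  · obtain ⟨p, hp, hpe⟩ := hi x hx y hy hxy
    rw [hpe]
    simp only [table, List.mem_cons, List.not_mem_nil, or_false] at hp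
    rcases hp with rfl | rfl | rfl <;> norm_num
  · rw [he a, length_vecs]
    simp only [table, List.map_cons, List.map_nil, List.sum_cons, List.sum_nil, Nat.cast_ofNat, Nat.cast_one]
    norm_num
    ring

/-- **`A(6, arccos 1/3) ≥ 32`**, attained side: `32` unit vectors of `ℝ^6` with pairwise inner products `≤ 1/3`.
[cite: ConwaySloane1999, Ch. 9 Table 9.2] -/
theorem exists_code_32 : ∃ C : Finset (EuclideanSpace ℝ (Fin 6)),
    C.card = 32 ∧ (∀ x ∈ C, ‖x‖ = 1) ∧ (∀ x ∈ C, ∀ y ∈ C, x ≠ y → inner ℝ x y ≤ 1 / 3) := by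
  obtain ⟨C, hc, hn, hi, _⟩ := exists_config
  exact ⟨C, hc, hn, hi⟩

/-- **`32 ≤ A(6, arccos 1/3) ≤ 35` in Lean** (attained: the `E₇` section; upper: the cell's kernel-checked three-point
SDP certificate `code_dim6_third_le_35_sdp`). [cite: ConwaySloane1999, Ch. 9 Table 9.2] -/
theorem code_dim6_third_bracket :
    (∃ C : Finset (EuclideanSpace ℝ (Fin 6)), C.card = 32 ∧ (∀ x ∈ C, ‖x‖ = 1) ∧
      (∀ x ∈ C, ∀ y ∈ C, x ≠ y → inner ℝ x y ≤ 1 / 3)) ∧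
    ∀ C : Finset (EuclideanSpace ℝ (Fin 6)), (∀ x ∈ C, ‖x‖ = 1) →
      (∀ x ∈ C, ∀ y ∈ C, x ≠ y → inner ℝ x y ≤ 1 / 3) → C.card ≤ 35 :=
  ⟨exists_code_32, ThreePointCert.C6T.code_dim6_third_le_35_sdp⟩

end Summit.Ventures.PackingBounds.Config.CodeThird6

namespace Summit.Ventures.PackingBounds.Config.CodeThird5

open Finset Summit.Ventures.PackingBounds.Config

/-- The `20` points `2w − u` (`w` a root of `E₆` with `w·u = 4`, `u = (0, 0, 0, 2, 2, 0, 0, 0)`), doubled `E₈` coordinates, norm `24`.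
[cite: ConwaySloane1999, Ch. 9 Table 9.2] -/
def vecs : List (List ℤ) := [
  [0, 0, 0, 2, -2, 4, 0, 0], [0, 0, 0, 2, -2, -4, 0, 0],
  [0, 0, 0, 2, -2, 0, 4, 0], [0, 0, 0, 2, -2, 0, -4, 0],
  [0, 0, 0, 2, -2, 0, 0, 4], [0, 0, 0, 2, -2, 0, 0, -4],
  [0, 0, 0, -2, 2, 4, 0, 0], [0, 0, 0, -2, 2, -4, 0, 0],
  [0, 0, 0, -2, 2, 0, 4, 0], [0, 0, 0, -2, 2, 0, -4, 0],
  [0, 0, 0, -2, 2, 0, 0, 4], [0, 0, 0, -2, 2, 0, 0, -4],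
  [2, -2, 2, 0, 0, 2, 2, -2], [2, -2, 2, 0, 0, 2, -2, 2],
  [2, -2, 2, 0, 0, -2, 2, 2], [2, -2, 2, 0, 0, -2, -2, -2],
  [-2, 2, -2, 0, 0, 2, 2, 2], [-2, 2, -2, 0, 0, 2, -2, -2],
  [-2, 2, -2, 0, 0, -2, 2, -2], [-2, 2, -2, 0, 0, -2, -2, 2]]
/-- Distance table: dot products `8, −8, −24` (cosines `1/3, −1/3, −1`) with multiplicities per point. -/
def table : List (ℤ × ℕ) := [(-24, 1), (-8, 9), (8, 9)]
/-- Normals cutting out the subspace: the `E₆` normals of the tree file and the root `u`. -/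
def normals : List (List ℤ) := [
  [2, 2, 0, 0, 0, 0, 0, 0], [-2, 2, 4, 0, 0, 0, 0, 0], [0, 0, 0, 2, 2, 0, 0, 0]]

/-- Kernel check: `20` coordinate lists. -/
theorem length_vecs : vecs.length = 20 := by decide +kernel

set_option maxRecDepth 100000 in
/-- Kernel check: every list has length `8` and squared length `24`. -/
private theorem shape_vecs : shapeOK vecs 8 (24 : ℤ) = true := by decide +kernel

/-- Kernel check: the table keys are distinct and differ from the squared length. -/
private theorem keys_table : keysOK table (24 : ℤ) = true := by decide +kernel

set_option maxRecDepth 100000 in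
/-- Kernel check: the distance distribution (`8 ×9, −8 ×9, −24 ×1` per point). -/
private theorem hist_vecs : histOK vecs table vecs = true := by decide +kernel

/-- The coordinate lists are pairwise distinct (from the checks). -/
private theorem nodup_vecs : vecs.Nodup := nodup_of_checks shape_vecs keys_table hist_vecs

/-- Kernel check: the normals have length `8`, are nonzero and pairwise orthogonal. -/
private theorem normals_ok : normalsOK normals 8 = true := by decide +kernel

set_option maxRecDepth 100000 in
/-- Kernel check: every point is orthogonal to every normal. -/
private theorem orth_ok : orthOK normals vecs = true := by decide +kernel

/-- `ι q > 0`. -/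
private theorem hq : 0 < (Int.castRingHom ℝ) (24 : ℤ) := by simp

/-- **The configuration in `ℝ^5`**: `20` unit vectors with pairwise inner products in `{1/3, −1/3, −1}` and the
tabulated energy. -/
theorem exists_config : ∃ C : Finset (EuclideanSpace ℝ (Fin 5)), C.card = 20 ∧ (∀ x ∈ C, ‖x‖ = 1) ∧
    (∀ x ∈ C, ∀ y ∈ C, x ≠ y → inner ℝ x y ≤ 1 / 3) ∧
    ∀ a : ℝ → ℝ, ∑ x ∈ C, ∑ y ∈ C.erase x, a (inner ℝ x y) =
      (20 : ℝ) * (a (-1) + 9 * a (-1 / 3) + 9 * a (1 / 3)) := by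
  obtain ⟨C, hc, hn, hi, he⟩ := exists_section Int.cast_injective hq shape_vecs keys_table hist_vecs
    nodup_vecs normals normals_ok orth_ok (n := 5) (by decide)
  refine ⟨C, by rw [hc, length_vecs], hn, fun x hx y hy hxy => ?_, fun a => ?_⟩
  · obtain ⟨p, hp, hpe⟩ := hi x hx y hy hxy
    rw [hpe]
    simp only [table, List.mem_cons, List.not_mem_nil, or_false] at hp
    rcases hp with rfl | rfl | rfl <;> norm_num
  · rw [he a, length_vecs]
    simp only [table, List.map_cons, List.map_nil, List.sum_cons, List.sum_nil, Nat.cast_ofNat, Nat.cast_one]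
    norm_num
    ring

/-- **`A(5, arccos 1/3) ≥ 20`**, attained side: `20` unit vectors of `ℝ^5` with pairwise inner products `≤ 1/3`.
[cite: ConwaySloane1999, Ch. 9 Table 9.2] -/
theorem exists_code_20 : ∃ C : Finset (EuclideanSpace ℝ (Fin 5)),
    C.card = 20 ∧ (∀ x ∈ C, ‖x‖ = 1) ∧ (∀ x ∈ C, ∀ y ∈ C, x ≠ y → inner ℝ x y ≤ 1 / 3) := by
  obtain ⟨C, hc, hn, hi, _⟩ := exists_config
  exact ⟨C, hc, hn, hi⟩

/-- **`20 ≤ A(5, arccos 1/3) ≤ 23` in Lean** (attained: the `E₆` section; upper: the cell's kernel-checked three-point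
SDP certificate `code_dim5_third_le_23_sdp`). [cite: ConwaySloane1999, Ch. 9 Table 9.2] -/
theorem code_dim5_third_bracket :
    (∃ C : Finset (EuclideanSpace ℝ (Fin 5)), C.card = 20 ∧ (∀ x ∈ C, ‖x‖ = 1) ∧
      (∀ x ∈ C, ∀ y ∈ C, x ≠ y → inner ℝ x y ≤ 1 / 3)) ∧
    ∀ C : Finset (EuclideanSpace ℝ (Fin 5)), (∀ x ∈ C, ‖x‖ = 1) →
      (∀ x ∈ C, ∀ y ∈ C, x ≠ y → inner ℝ x y ≤ 1 / 3) → C.card ≤ 23 :=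
  ⟨exists_code_20, ThreePointCert.C5T.code_dim5_third_le_23_sdp⟩

end Summit.Ventures.PackingBounds.Config.CodeThird5
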